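import Summits.ResolutionOfSingularities.ResolutionOfSingularities.Theorems.FrobeniusClosingPatchingRelPerfectDepthWeightedCleanupSNC
import Summits.ResolutionOfSingularities.ResolutionOfSingularities.Theorems.FrobeniusClosingPatchingRelPerfectDepthWeightedSeqTransport
import Summits.ResolutionOfSingularities.ResolutionOfSingularities.Theorems.FrobeniusClosingPatchingRelPerfectDepthFlagTargets
import HarnessLib

/-!
# Crux `PatchingRelPerfect` (stmt-ResolutionOfSingularities-16161), chain W5.2 — T6-E1b residual `LegalDivisorReduction₃`,
# PHASE 3 «PEELS + FINAL SEPARATION»: an snc-SUPPORTED locally principal ideal is brought to order `≤ 1` everywhere by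
# weight-two-LEGAL blowings up — BY NAME over the tree's weight-two cleanup

[OURS · L1 W5.2 · LSDR₃/LDR₃ hand #3 (res-L1-w52-plan-1 STEER 5 (3) 2026-08-27T11:32:42Z, RULING R3a 11:49:54Z: «PEEL … PHASE 3 …
compositions»)] Replaces the role of NO printed item; NOT a statement of the manuscript under review; fact-free.

The OURS residual `LegalDivisorReduction₃` of TargetsF6's stage 1 (res-L1-w52-idea-1, Sketch v9 §9 (9e): weight-two-LEGAL order
reduction of the principal marked ideal `(H, 2)` on a regular excellent threefold — centres `C` regular with `H_k ≤ 𝓘_C²`, transform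
`H_{k+1} = τᶜ(H_k, 2)`, until `ord H_m ≤ 1` everywhere) is cut by the planner (R3a (3)) into PHASE 1 (CJS truncated at the first regular
stage, F-32♯a), PEEL, PHASE 2 (F-60♯ on the regular strict transform against the odd exceptionals) and PHASE 3 (separate the coefficient-one
pairs along their double curves). This file records that **PEEL + PHASE 3 are ALREADY IN THE TREE BY CONTENT**: they are the case `μ = 2`
of res-D-pv-054's F2 target (a) `DepthTargets.weightedCleanupSNC_holds : ∀ μ, WeightedCleanupSNC μ`
(`…DepthWeightedCleanupSNC.lean`: Kollár (3.111) Step 3 on the monomial presentation `H = ∏ 𝓘(D_k)^{a_k}` of an snc-supported locally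
principal ideal — its phase `r = 1` blows up the components of coefficient `a_k ≥ 2` (= the PEELS, identity blowings up along Cartier
centres), its phases `r ≥ 2` the strata `D_i ∩ D_j (∩ D_k)` of weight `≥ 2` (= the SEPARATION); every centre is regular with `H_j ≤ C²`
— weight-two LEGAL — and the transform is `τᶜ(·, 2)`), composed with the transport of the state clauses along pure weighted sequences
(`DepthTargets.IsPureWeightedSeq.transport`, `…DepthWeightedSeqTransport.lean`):

* `legalSeparation₃` — for `E` integral Noetherian regular excellent of dimension three and `H ≠ ⊥` locally principal whose support lies
  in a strict normal crossings divisor `B`, there is a PURE WEIGHT-TWO sequence `IsPureWeightedSeq 2 ρ H H'` to a state on an integral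
  Noetherian regular excellent `E'` of dimension three with `H' ≠ ⊥` locally principal and `ord_x H' ≤ 1` for every `x` (the input shape
  «`∃ B, IsStrictNormalCrossingsDivisor E B ∧ Supp H ⊆ B`» is exactly PHASE 2's output «`X‴ ∪ B‴` snc `⊇ Supp H‴`»);
* `legalSeparation` — the same in every dimension, without the excellence/dimension clauses (they are only carried, never used);
* `idealOrder_le_one_of_lt_two` — the reading `ord < 2 ⇒ ord ≤ 1` in `ℕ∞`.

The FLAG-format reading (`IsFlagSeq ρ H H H' H'`, `FlagState₃ E' H' H'`, `EndFlag H' H'` — the diagonal `𝔟 = R₁ = H` of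
`…DepthFlagTargets`) is the one-line composition with res-D-pv-016's diagonal currency (`IsFlagSeq.of_isPureWeightedSeq`,
`endFlag_self_iff`, `…DepthFlagDiagonal.lean`) and lands as a sibling once that module is in the tree.

AI-written; AI review is weaker than expert review.

## References
* J. Kollár, *Lectures on Resolution of Singularities* (2007), (3.111) Step 3. [Kollar2007]
* E. Bierstone, D. Grigoriev, P. Milman, J. Włodarczyk, arXiv:1206.3090, §4 Step 2b, Def. 3.1.3, Lemma 3.2.1.
  [BierstoneGrigorievMilmanWlodarczyk2011]
-/

-- `Summit.<Summit>.<Sub>.Theorems` with `Sub = Summit` (single-conjunct summit, D-0017)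
set_option linter.dupNamespace false

noncomputable section

open CategoryTheory CategoryTheory.Limits AlgebraicGeometry TopologicalSpace
open Literature.AlgebraicGeometry.Resolution

namespace Summit.ResolutionOfSingularities.ResolutionOfSingularities.Theorems

universe u

namespace DepthLegal

open DepthTargets

/-- `ord < 2 ⇒ ord ≤ 1` in `ℕ∞`. [folklore] -/
theorem idealOrder_le_one_of_lt_two {E : Scheme.{u}} {H : E.IdealSheafData} {x : E}
    (h : idealOrder H x < ((2 : ℕ) : ℕ∞)) : idealOrder H x ≤ 1 := by
  have h2 : ((2 : ℕ) : ℕ∞) = (1 : ℕ∞) + 1 := by norm_num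
  rw [h2] at h
  exact ENat.lt_add_one_iff (ENat.coe_ne_top 1) |>.mp h

/-- [OURS · L1 W5.2] **LEGAL SEPARATION, any dimension**: on an integral Noetherian regular scheme `E`, a non-zero locally principal
`H` whose support lies in a strict normal crossings divisor `B` is carried by a PURE WEIGHT-TWO sequence (regular centres `C` with
`H_j ≤ C²`, transform `τᶜ(·, 2)` — peels of the coefficient-`≥ 2` components, then the double-curve / triple-point strata, Kollár
(3.111) Step 3) to `H'` on an integral Noetherian regular `E'` with `H' ≠ ⊥` locally principal and `ord_x H' ≤ 1` everywhere;
excellence and the dimension are carried along. By name: `weightedCleanupSNC_holds 2` + `IsPureWeightedSeq.transport`.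
[cite: Kollar2007, (3.111) Step 3] [cite: BierstoneGrigorievMilmanWlodarczyk2011, §4 Step 2b] -/
theorem legalSeparation (E : Scheme.{u}) [IsIntegral E] [IsNoetherian E] (hreg : Scheme.IsRegular E)
    (H : E.IdealSheafData) (hH : H ≠ ⊥) (hlp : IsLocallyPrincipal H)
    (hsnc : ∃ B : Set E, IsStrictNormalCrossingsDivisor E B ∧ (H.support : Set E) ⊆ B) :
    ∃ (E' : Scheme.{u}) (ρ : E' ⟶ E) (H' : E'.IdealSheafData),
      IsPureWeightedSeq 2 ρ H H' ∧ IsIntegral E' ∧ IsNoetherian E' ∧ Scheme.IsRegular E' ∧ H' ≠ ⊥ ∧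
        IsLocallyPrincipal H' ∧ (Scheme.IsExcellent E → Scheme.IsExcellent E') ∧
        (∀ n : ℕ, topologicalKrullDim E = n → topologicalKrullDim E' = n) ∧ ∀ x : E', idealOrder H' x ≤ 1 := by
  obtain ⟨B, hB, hsupp⟩ := hsnc
  obtain ⟨E', ρ, H', hseq, hord⟩ := weightedCleanupSNC_holds.{u} 2 (by norm_num) E hreg B hB H hH hlp hsupp
  obtain ⟨hint, hnoeth, hreg', hne, -, hlp', hexc, hdim, -⟩ := hseq.transport (by norm_num) hreg hH
  exact ⟨E', ρ, H', hseq, hint, hnoeth, hreg', hne, hlp' hlp, hexc, hdim, fun x => idealOrder_le_one_of_lt_two (hord x)⟩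

/-- [OURS · L1 W5.2] **LEGAL SEPARATION on a regular excellent threefold — PHASE 3 (with the PEELS) of the planner's cut of
`LegalDivisorReduction₃`** (RULING R3a (3)), in res-D-pv-016's one-ideal currency `IsPureWeightedSeq 2`: input shape = PHASE 2's output
«`Supp H ⊆ B`, `B` a strict normal crossings divisor»; output = an integral Noetherian regular excellent `E'` of dimension three and
`H' ≠ ⊥` locally principal of order `≤ 1` everywhere, i.e. the `EndFlag H' H'` / `FlagState₃ E' H' H'` state of the diagonal flag.
[cite: Kollar2007, (3.111) Step 3] -/
theorem legalSeparation₃ (E : Scheme.{u}) [IsIntegral E] [IsNoetherian E] (hreg : Scheme.IsRegular E)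
    (hexc : Scheme.IsExcellent E) (hdim : topologicalKrullDim E = 3) (H : E.IdealSheafData) (hH : H ≠ ⊥)
    (hlp : IsLocallyPrincipal H) (hsnc : ∃ B : Set E, IsStrictNormalCrossingsDivisor E B ∧ (H.support : Set E) ⊆ B) :
    ∃ (E' : Scheme.{u}) (ρ : E' ⟶ E) (H' : E'.IdealSheafData),
      IsPureWeightedSeq 2 ρ H H' ∧ IsIntegral E' ∧ IsNoetherian E' ∧ Scheme.IsRegular E' ∧ Scheme.IsExcellent E' ∧
        topologicalKrullDim E' = 3 ∧ H' ≠ ⊥ ∧ IsLocallyPrincipal H' ∧ ∀ x : E', idealOrder H' x ≤ 1 := by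
  obtain ⟨E', ρ, H', hseq, hint, hnoeth, hreg', hne, hlp', hexc', hdim', hord⟩ := legalSeparation E hreg H hH hlp hsnc
  exact ⟨E', ρ, H', hseq, hint, hnoeth, hreg', hexc' hexc, hdim' 3 hdim, hne, hlp', hord⟩

end DepthLegal

end Summit.ResolutionOfSingularities.ResolutionOfSingularities.Theorems

end
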